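/-
Cell pub-lace10 (typer seat), lead ruling D7/D8: the "(plusT)" (= lace7 token `h2phi`) Tables form of Step 2 of [NoBLE17] §3.3.5 and its
propagation through the §3.3.5 assembly to the six cells of `f₃` and the improvement-step input — PLUMBING ONLY.  The analytic content
(`NobleH2Step.abs_integral_H2_diagram_le`: the bound DERIVED from (3.53) with slot `β_{R,Φ}` and factor `(Γ₂′)ⁿ`) is already in the tree;
this module removes the side condition (H-Γ) `Γ₂′ⁿ β_{R,Φ} ≤ β_{ΔR,Φ}` under which that bound was compared with the PRINTED cell `boundH2`.
d-generic; no numeral, no dimension, no named fact; `F3Bounds`, `NobleH2Step`, `NobleWeightedDiagramAssembly`, `NobleWeightedDiagramBound` untouched.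
-/
import Literature.Probability.FitznerVanDerHofstad2017.NobleWeightedDiagramBound
import HarnessLib

/-!
# Literature.Probability.FitznerVanDerHofstad2017.NobleWeightedDiagramBoundPhi — Step 2 of [NoBLE17] §3.3.5 in the DERIVED ("plusT") Tables
# form `boundH2Phi`, and the §3.3.5 assembly / six cells / improvement input re-cut on it (no (H-Γ) side condition)

[NoBLE17] = Fitzner–van der Hofstad, *Generalized approach to the non-backtracking lace expansion*, PTRF 169 (2017) 1041–1119.

WHAT IS IN THE TREE ALREADY.  `NobleH2Step.abs_integral_H2_diagram_le` proves, from the pointwise key bounds `KeyBounds r` of [NoBLE17] §3.3.4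
((3.40)–(3.47), (3.53)), for `d ≥ 2n + 7`:

  `|∫ Ĥ₂ Ĝⁿ D̂^l D̂^{(x)} dk/(2π)^d| ≤ Γ₂′ⁿ (β_{|ΔR,F|} K̲ c̄_Φ (1/α̲_F + K̲) + ᾱ_F β_{R,Φ} K̲²) TS_{n+2,l}(x)
                                   + Γ₂′ⁿ (β_{|ΔR,F|} K̲ β_{α,Φ} (1/α̲_F + K̲)) TS_{n+2,l+1}(x) + Γ₂′ⁿ (β_{|ΔR,F|} K̲ β_{α,Φ}/α̲_F) TS_{n+1,l}(x)`      (✶)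

(`TS_{m,l} = srwTS`), i.e. the last summand of Step 2 in the form `ᾱ_F · β_{R,Φ} · K̲² · (Γ₂′)ⁿ · T*_{n+2,l}(x)` that the printed derivation
(2.11) ∧ (3.46) ∧ (3.47) ∧ (3.53) establishes ("(plusT)"), whereas the printed display (3.74) / `General.nb` `BoundH[2]` (= `F3Bounds.boundH2`)
carries `ᾱ_F β_{ΔR,Φ} K̲² T*_{n+2,l}(x)` there; the tree's Tables form `abs_integral_H2_diagram_le_boundH2` therefore needs the extra hypothesis
(H-Γ) `Γ₂′ⁿ β_{R,Φ} ≤ β_{ΔR,Φ}` (b2b DIVERGENCE D79; lace7 referee L5-ADJUDICATION §4: "(plusT) ≤ printed last summand ⟺ (Γ₂′)ⁿ β_{R,Φ} ≤ β_{ΔR,Φ}").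

THIS MODULE (bookkeeping; every proof is the tree's proof with (H-Γ) deleted, or a comparison of two explicit cell formulas):
* §1 `F3Bounds.boundH2Phi τ n l v a` — the Tables form of the right side of (✶) (the three `TS`-slots read from `τ.T`): `boundH2` with its last term
  `a.afmax * a.bRpDelta * K̲² * T(n+2,l)` replaced by `a.afmax * a.bRp * a.Gamma2dash^n * K̲² * T(n+2,l)`; `boundHD75Phi = boundH1 + boundH2Phi + boundH3 +
  boundH4D75 + boundH5` (the cell with Step 2 in this form and Step 4 App.-C-consistent, `F3BoundsD75`), its node maximum `boundFThreeD75Phi`; the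
  comparisons `boundH2Phi ≤ boundH2`, `boundHD75Phi ≤ boundHD75` UNDER (H-Γ) (so every certificate row proved on the printed cell under (H-Γ) is implied
  by the corresponding row on the Phi cell, and the Phi cell is the one to use when (H-Γ) is not available).
* §2 `abs_integral_H2_diagram_le_boundH2Phi` (+ `_lapAtomsAt`): (✶) `≤ boundH2Phi τ n l x r` for a table with `srwTS ≤ τ.T` and well-formed `r` — NO (H-Γ).
* §3 the §3.3.5 assembly with the five per-piece bounds as ARBITRARY reals (`abs_nobleH_le_sum_of_pieces`; the proof of
  `NobleWeightedDiagramAssembly.abs_nobleH_le_boundHD75_of_pieces` verbatim with the cell unfolded), and its `boundHD75Phi` instance.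
* §4 the consumers of `NobleWeightedDiagramBound` re-cut on `boundHD75Phi` without (H-Γ): `abs_nobleH_le_boundHD75Phi_of_step1`,
  `NobleF3Witness.abs_nobleH_le_boundHD75Phi`, `abs_nobleH_le_boundHD75Phi_of_witness`, the six cells `nobleWeightedDiagramBoundAt_of_witness_phi` /
  `nobleWeightedDiagramBoundAt_of_simplifiedFormF3_phi`, and the improvement-step input `nobleImprovementInputsAt_of_simplifiedFormF3_phi`.
What remains displayed after this module is what remained after `NobleWeightedDiagramBound` MINUS (H-Γ): Step 1 (`hStep1`, leaf `NobleH1Step` /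
`NobleH1StepD80`), the table side `τ.K = srwK`, `τ.U = srwU`, `srwTS ≤ τ.T`, and the per-cell numerics — now against `boundHD75Phi`.
HONEST LABEL: composition only; no estimate is proved here that is not already a tree theorem; no dimension-specific sentence.
[cite: FitznerVanDerHofstad2016NoBLE, §3.3.5 Step 2 (3.72)–(3.74) p. 1077 with (3.53) p. 1073, (3.58)–(3.59) p. 1074, (3.87) p. 1079; Assumption 2.7 (c) (2.11)–(2.12) p. 1059; §3.3.4 (3.46)–(3.47) p. 1072]
[cite: FitznerVanDerHofstad2017, §2.5 (EJP p. 16) and notebook General.nb In[2]–In[3] `BoundH[2]`, `BoundHn`]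
-/

noncomputable section

open MeasureTheory Real
open Literature.Barriers.CriticalPhenomena
open Literature.Barriers.CriticalPhenomena.Slade2006Prop53 (P)
open Literature.Probability.LatticeModels
open Literature.Probability.Percolation
open Literature.Probability.RandomPlanarGeometry.SAW.Zd (normSq)

namespace Literature.Probability.FitznerVanDerHofstad2017

variable {d : ℕ}

/-! ## 1. The Step-2 cell in the derived form and the five-piece cell built on it -/

namespace F3Bounds

variable {ν : Type*}

/-- **`BoundH[2]` in the DERIVED ("plusT") form**: the Tables form of (✶) —
`β_{|ΔR,F|} Γ₂′ⁿ K̲ [(c̄_Φ T_{n+2,l} + β_{α,Φ} T_{n+2,l+1})(1/α̲_F + K̲) + (β_{α,Φ}/α̲_F) T_{n+1,l}] + ᾱ_F β_{R,Φ} Γ₂′ⁿ K̲² T_{n+2,l}`,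
i.e. `F3Bounds.boundH2` with the slot `β_{ΔR,Φ}` of its last term replaced by `β_{R,Φ} Γ₂′ⁿ` (what (2.11), (3.46), (3.47), (3.53) give).
[cite: FitznerVanDerHofstad2016NoBLE, §3.3.5 (3.73)–(3.74) p. 1077 with (3.53) p. 1073 and Assumption 2.7 (c) (2.11) p. 1059] -/
def boundH2Phi (τ : Tables ν) (n l : ℕ) (v : ν) (a : Args) : ℝ :=
  a.bRfDelta * a.Gamma2dash ^ n * a.Kunderline
      * ((a.cp * τ.T (n+2) l v + a.ap * τ.T (n+2) (l+1) v) * (1 / a.afmin + a.Kunderline)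
          + a.ap / a.afmin * τ.T (n+1) l v)
    + a.afmax * a.bRp * a.Gamma2dash ^ n * a.Kunderline ^ 2 * τ.T (n+2) l v

/-- The five-piece cell with Step 2 in the derived form and Step 4 App.-C-consistent: `boundH1 + boundH2Phi + boundH3 + boundH4D75 + boundH5`.
[cite: FitznerVanDerHofstad2016NoBLE, §3.3.5 (3.59) p. 1074 and (3.87) p. 1079] -/
def boundHD75Phi (τ : Tables ν) (n l : ℕ) (v : ν) (a : Args) : ℝ :=
  boundH1 τ n l v a + boundH2Phi τ n l v a + boundH3 τ n l v a + boundH4D75 τ n l v a + boundH5 τ n l v a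

/-- The cell maximum of `boundHD75Phi` over the nodes `v ∈ v₀ :: vs` (as `boundFThreeD75`). [cite: FitznerVanDerHofstad2016NoBLE, §3.3.5 (3.87) p. 1079] -/
def boundFThreeD75Phi (τ : Tables ν) (n l : ℕ) (v₀ : ν) (vs : List ν) (a : Args) : ℝ :=
  vs.foldr (fun v acc => max (boundHD75Phi τ n l v a) acc) (boundHD75Phi τ n l v₀ a)

/-- The two Step-2 cells differ exactly in the last term: `boundH2 − boundH2Phi = ᾱ_F K̲² T_{n+2,l} · (β_{ΔR,Φ} − Γ₂′ⁿ β_{R,Φ})` — the printed (3.74) last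
summand `ᾱ_F β_{ΔR,Φ} K̲² T*_{n+2,l}` against the one derived from (3.53), `ᾱ_F β_{R,Φ} Γ₂′ⁿ K̲² T*_{n+2,l}`.
[cite: FitznerVanDerHofstad2016NoBLE, §3.3.5 (3.73)–(3.74) p. 1077 with (3.53) p. 1073] -/
theorem boundH2_sub_boundH2Phi (τ : Tables ν) (n l : ℕ) (v : ν) (a : Args) :
    boundH2 τ n l v a - boundH2Phi τ n l v a = a.afmax * a.Kunderline ^ 2 * τ.T (n+2) l v * (a.bRpDelta - a.Gamma2dash ^ n * a.bRp) := by
  unfold boundH2 boundH2Phi; ring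

/-- **Under (H-Γ) the derived cell is the smaller one**: `Γ₂′ⁿ β_{R,Φ} ≤ β_{ΔR,Φ}`, `0 ≤ ᾱ_F`, `0 ≤ T_{n+2,l}` give `boundH2Phi ≤ boundH2`
(the comparison of L5-ADJUDICATION §4 / DIVERGENCE D79 at the level of the cells). [cite: FitznerVanDerHofstad2016NoBLE, §3.3.5 (3.74) p. 1077; Assumption 2.7 (c) (2.11)–(2.12) p. 1059] -/
theorem boundH2Phi_le_boundH2 {τ : Tables ν} {n l : ℕ} {v : ν} {a : Args} (hΓ : a.Gamma2dash ^ n * a.bRp ≤ a.bRpDelta)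
    (hafx : 0 ≤ a.afmax) (hT : 0 ≤ τ.T (n+2) l v) : boundH2Phi τ n l v a ≤ boundH2 τ n l v a := by
  have h := boundH2_sub_boundH2Phi τ n l v a
  have : 0 ≤ a.afmax * a.Kunderline ^ 2 * τ.T (n+2) l v * (a.bRpDelta - a.Gamma2dash ^ n * a.bRp) :=
    mul_nonneg (mul_nonneg (mul_nonneg hafx (sq_nonneg _)) hT) (sub_nonneg.2 hΓ)
  linarith

/-- Hence `boundHD75Phi ≤ boundHD75` under (H-Γ): a certificate row `boundHD75 ≤ b` proved under (H-Γ) follows from `boundHD75Phi ≤ b` never the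
other way round; without (H-Γ) only the Phi cell is available. [cite: FitznerVanDerHofstad2016NoBLE, §3.3.5 (3.87) p. 1079] -/
theorem boundHD75Phi_le_boundHD75 {τ : Tables ν} {n l : ℕ} {v : ν} {a : Args} (hΓ : a.Gamma2dash ^ n * a.bRp ≤ a.bRpDelta)
    (hafx : 0 ≤ a.afmax) (hT : 0 ≤ τ.T (n+2) l v) : boundHD75Phi τ n l v a ≤ boundHD75 τ n l v a := by
  unfold boundHD75Phi boundHD75
  linarith [boundH2Phi_le_boundH2 hΓ hafx hT]

end F3Bounds

/-! ## 2. Step 2, Tables form, derived cell — no (H-Γ) -/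

section Integrated

variable {n : ℕ} {A : (Fin d → ℝ) → LapAtoms} {r : F3Bounds.Args}

/-- **Tables form of Step 2 on the derived cell**: for atoms obeying `KeyBounds r` on the cube off `{D̂ = 1}` carrying `D = D̂`, `Dsin = D̂^{sin}`,
well-formed `r`, and a table with `TS_{m,l}(x) ≤ τ.T m l x`, `|∫ Ĥ₂ Ĝⁿ D̂^l D̂^{(x)} dk/(2π)^d| ≤ boundH2Phi τ n l x r` (`d ≥ 2n + 7`) — the tree's
`abs_integral_H2_diagram_le` read at the table, WITHOUT the side condition (H-Γ) that the printed cell `boundH2` requires.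
[cite: FitznerVanDerHofstad2016NoBLE, §3.3.5 (3.72)–(3.74) p. 1077 with (3.53) p. 1073, (3.46)–(3.47) p. 1072, (2.11) p. 1059] -/
theorem abs_integral_H2_diagram_le_boundH2Phi (hd : 2 * (n + 3) + 1 ≤ d)
    (hA : ∀ k ∈ cube d, Dhat d k < 1 → (A k).KeyBounds r) (hAD : ∀ k, (A k).D = Dhat d k)
    (hADs : ∀ k, (A k).Dsin = Dsin d k) (hr : r.WF)
    (τ : F3Bounds.Tables (Fin d → ℤ)) (hT : ∀ m l x, srwTS d r.afmin m l x ≤ τ.T m l x) (l : ℕ) (x : Fin d → ℤ) :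
    |(∫ k, (A k).H2 * (A k).G ^ n * Dhat d k ^ l * DhatSym d x k ∂P d) / (2 * π) ^ d| ≤ F3Bounds.boundH2Phi τ n l x r := by
  refine (abs_integral_H2_diagram_le hd hA hAD hADs l x).trans ?_
  obtain ⟨hΓ, hcp, haf, hafx, hap, hbp, hbF, -, hK⟩ := hr
  have hT1 := hT (n + 2) l x
  have hT2 := hT (n + 2) (l + 1) x
  have hT3 := hT (n + 1) l x
  have a1 : 0 ≤ r.Gamma2dash ^ n *
      (r.bRfDelta * r.Kunderline * r.cp * (1 / r.afmin + r.Kunderline) + r.afmax * r.bRp * r.Kunderline ^ 2) := by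
    positivity
  have a2 : 0 ≤ r.Gamma2dash ^ n * (r.bRfDelta * r.Kunderline * r.ap * (1 / r.afmin + r.Kunderline)) := by positivity
  have a3 : 0 ≤ r.Gamma2dash ^ n * (r.bRfDelta * r.Kunderline * (r.ap / r.afmin)) := by positivity
  have e1 := mul_le_mul_of_nonneg_left hT1 a1
  have e2 := mul_le_mul_of_nonneg_left hT2 a2
  have e3 := mul_le_mul_of_nonneg_left hT3 a3
  unfold F3Bounds.boundH2Phi
  linarith [e1, e2, e3]

end Integrated

/-- Step 2 on the derived cell at the atoms `lapAtomsAt` (whose `D`, `Dsin` are `D̂`, `D̂^{sin}` by construction), Tables form, no (H-Γ).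
[cite: FitznerVanDerHofstad2016NoBLE, §3.3.5 (3.58), (3.72)–(3.74) pp. 1074–1077] -/
theorem abs_integral_H2_diagram_le_boundH2Phi_lapAtomsAt {n : ℕ} (hd : 2 * (n + 3) + 1 ≤ d)
    {cΦ αΦ cF αF : ℝ} {RΦ RF : Site d → ℝ} {r : F3Bounds.Args}
    (hKB : ∀ k ∈ cube d, Dhat d k < 1 → (lapAtomsAt d cΦ αΦ cF αF RΦ RF k).KeyBounds r)
    (hr : r.WF) (τ : F3Bounds.Tables (Fin d → ℤ)) (hT : ∀ m l x, srwTS d r.afmin m l x ≤ τ.T m l x) (l : ℕ) (x : Fin d → ℤ) :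
    |(∫ k, (lapAtomsAt d cΦ αΦ cF αF RΦ RF k).H2 * (lapAtomsAt d cΦ αΦ cF αF RΦ RF k).G ^ n *
        Dhat d k ^ l * DhatSym d x k ∂P d) / (2 * π) ^ d| ≤ F3Bounds.boundH2Phi τ n l x r :=
  abs_integral_H2_diagram_le_boundH2Phi hd hKB (fun _ => rfl) (fun _ => rfl) hr τ hT l x

/-! ## 3. The §3.3.5 assembly with arbitrary per-piece bounds, and on the derived cell -/

/-- **[NoBLE17] (3.59) with the triangle inequality, per-piece bounds ARBITRARY**: below `p_c` (`d ≥ 2n + 5`), for a simplified-form witness with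
summable remainders of finite absolute second moment whose atoms obey `KeyBounds r` off `{D̂ = 1}`, if the five signed piece integrands are integrable and
`|∫ Ĥ_i Ĝⁿ D̂^l D̂^{(x)} dk/(2π)^d| ≤ B_i` (`i = 1,…,5`), then `|ℋ^{n,l}_p(x)| ≤ B₁ + B₂ + B₃ + B₄ + B₅`.  (The proof of
`abs_nobleH_le_boundHD75_of_pieces` with the cell left abstract.) [cite: FitznerVanDerHofstad2016NoBLE, §3.3.5 (3.58)–(3.59) p. 1074; §3.3.4 (3.57) p. 1074] -/
theorem abs_nobleH_le_sum_of_pieces {n : ℕ} (hd : 2 * (n + 2) + 1 ≤ d) {p : unitInterval}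
    (hp : (p : ℝ) < criticalProb (zdGraph d) (0 : Site d)) {cΦ αΦ cF αF : ℝ} {RΦ RF : Site d → ℝ}
    (hRΦ : Summable RΦ) (hRF : Summable RF) (hRΦ2 : Summable fun x => normSq x * |RΦ x|)
    (hRF2 : Summable fun x => normSq x * |RF x|)
    (hform : ∀ k ∈ cube d,
      tauHat d p k * (1 - (cF + αF * Dhat d k + cosFT RF k)) = cΦ + αΦ * Dhat d k + cosFT RΦ k)
    {r : F3Bounds.Args} (hKB : ∀ k ∈ cube d, Dhat d k < 1 → (lapAtomsAt d cΦ αΦ cF αF RΦ RF k).KeyBounds r)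
    (l : ℕ) (x : Site d) {B₁ B₂ B₃ B₄ B₅ : ℝ}
    (hI1 : Integrable (fun k => (lapAtomsAt d cΦ αΦ cF αF RΦ RF k).H1 * (lapAtomsAt d cΦ αΦ cF αF RΦ RF k).G ^ n *
      Dhat d k ^ l * DhatSym d x k) (P d))
    (hI2 : Integrable (fun k => (lapAtomsAt d cΦ αΦ cF αF RΦ RF k).H2 * (lapAtomsAt d cΦ αΦ cF αF RΦ RF k).G ^ n *
      Dhat d k ^ l * DhatSym d x k) (P d))
    (hI3 : Integrable (fun k => (lapAtomsAt d cΦ αΦ cF αF RΦ RF k).H3 * (lapAtomsAt d cΦ αΦ cF αF RΦ RF k).G ^ n *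
      Dhat d k ^ l * DhatSym d x k) (P d))
    (hI4 : Integrable (fun k => (lapAtomsAt d cΦ αΦ cF αF RΦ RF k).H4 * (lapAtomsAt d cΦ αΦ cF αF RΦ RF k).G ^ n *
      Dhat d k ^ l * DhatSym d x k) (P d))
    (hI5 : Integrable (fun k => (lapAtomsAt d cΦ αΦ cF αF RΦ RF k).H5 * (lapAtomsAt d cΦ αΦ cF αF RΦ RF k).G ^ n *
      Dhat d k ^ l * DhatSym d x k) (P d))
    (hH1 : |(∫ k, (lapAtomsAt d cΦ αΦ cF αF RΦ RF k).H1 * (lapAtomsAt d cΦ αΦ cF αF RΦ RF k).G ^ n *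
        Dhat d k ^ l * DhatSym d x k ∂P d) / (2 * π) ^ d| ≤ B₁)
    (hH2 : |(∫ k, (lapAtomsAt d cΦ αΦ cF αF RΦ RF k).H2 * (lapAtomsAt d cΦ αΦ cF αF RΦ RF k).G ^ n *
        Dhat d k ^ l * DhatSym d x k ∂P d) / (2 * π) ^ d| ≤ B₂)
    (hH3 : |(∫ k, (lapAtomsAt d cΦ αΦ cF αF RΦ RF k).H3 * (lapAtomsAt d cΦ αΦ cF αF RΦ RF k).G ^ n *
        Dhat d k ^ l * DhatSym d x k ∂P d) / (2 * π) ^ d| ≤ B₃)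
    (hH4 : |(∫ k, (lapAtomsAt d cΦ αΦ cF αF RΦ RF k).H4 * (lapAtomsAt d cΦ αΦ cF αF RΦ RF k).G ^ n *
        Dhat d k ^ l * DhatSym d x k ∂P d) / (2 * π) ^ d| ≤ B₄)
    (hH5 : |(∫ k, (lapAtomsAt d cΦ αΦ cF αF RΦ RF k).H5 * (lapAtomsAt d cΦ αΦ cF αF RΦ RF k).G ^ n *
        Dhat d k ^ l * DhatSym d x k ∂P d) / (2 * π) ^ d| ≤ B₅) :
    |nobleH d n l p x| ≤ B₁ + B₂ + B₃ + B₄ + B₅ := by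
  have hd2 : 2 ≤ d := by omega
  have hae := ae_nobleH_integrand_eq_sum_pieces hd2 hp hRΦ hRF hRΦ2 hRF2 hform hKB n l x
  have hI12 : Integrable (fun k =>
      (lapAtomsAt d cΦ αΦ cF αF RΦ RF k).H1 * (lapAtomsAt d cΦ αΦ cF αF RΦ RF k).G ^ n * Dhat d k ^ l * DhatSym d x k +
      (lapAtomsAt d cΦ αΦ cF αF RΦ RF k).H2 * (lapAtomsAt d cΦ αΦ cF αF RΦ RF k).G ^ n * Dhat d k ^ l * DhatSym d x k) (P d) :=
    hI1.add hI2
  have hI123 : Integrable (fun k =>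
      (lapAtomsAt d cΦ αΦ cF αF RΦ RF k).H1 * (lapAtomsAt d cΦ αΦ cF αF RΦ RF k).G ^ n * Dhat d k ^ l * DhatSym d x k +
      (lapAtomsAt d cΦ αΦ cF αF RΦ RF k).H2 * (lapAtomsAt d cΦ αΦ cF αF RΦ RF k).G ^ n * Dhat d k ^ l * DhatSym d x k +
      (lapAtomsAt d cΦ αΦ cF αF RΦ RF k).H3 * (lapAtomsAt d cΦ αΦ cF αF RΦ RF k).G ^ n * Dhat d k ^ l * DhatSym d x k) (P d) :=
    hI12.add hI3
  have hI1234 : Integrable (fun k =>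
      (lapAtomsAt d cΦ αΦ cF αF RΦ RF k).H1 * (lapAtomsAt d cΦ αΦ cF αF RΦ RF k).G ^ n * Dhat d k ^ l * DhatSym d x k +
      (lapAtomsAt d cΦ αΦ cF αF RΦ RF k).H2 * (lapAtomsAt d cΦ αΦ cF αF RΦ RF k).G ^ n * Dhat d k ^ l * DhatSym d x k +
      (lapAtomsAt d cΦ αΦ cF αF RΦ RF k).H3 * (lapAtomsAt d cΦ αΦ cF αF RΦ RF k).G ^ n * Dhat d k ^ l * DhatSym d x k +
      (lapAtomsAt d cΦ αΦ cF αF RΦ RF k).H4 * (lapAtomsAt d cΦ αΦ cF αF RΦ RF k).G ^ n * Dhat d k ^ l * DhatSym d x k) (P d) :=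
    hI123.add hI4
  rw [nobleH_eq_integral hd2 n l p hp x, integral_congr_ae hae, integral_add hI1234 hI5, integral_add hI123 hI4,
    integral_add hI12 hI3, integral_add hI1 hI2]
  simp only [add_div]
  refine le_trans (abs_add_le _ _) ?_
  refine le_trans (add_le_add (abs_add_le _ _) le_rfl) ?_
  refine le_trans (add_le_add (add_le_add (abs_add_le _ _) le_rfl) le_rfl) ?_
  refine le_trans (add_le_add (add_le_add (add_le_add (abs_add_le _ _) le_rfl) le_rfl) le_rfl) ?_
  exact add_le_add (add_le_add (add_le_add (add_le_add hH1 hH2) hH3) hH4) hH5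

/-- **`|ℋ^{n,l}_p(x)| ≤ boundHD75Phi τ n l x r` from the pieces**: Step 4 discharged by the App.-C-consistent leaf (`boundH4D75`), Steps 1, 2 (derived
cell `boundH2Phi`), 3, 5 displayed as the conclusions of their leaves. [cite: FitznerVanDerHofstad2016NoBLE, §3.3.5 (3.58)–(3.59) p. 1074, (3.61)–(3.86) pp. 1075–1079] -/
theorem abs_nobleH_le_boundHD75Phi_of_pieces {n : ℕ} (hd : 2 * (n + 2) + 1 ≤ d) {p : unitInterval}
    (hp : (p : ℝ) < criticalProb (zdGraph d) (0 : Site d)) {cΦ αΦ cF αF : ℝ} {RΦ RF : Site d → ℝ}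
    (hRΦ : Summable RΦ) (hRF : Summable RF) (hRΦ2 : Summable fun x => normSq x * |RΦ x|)
    (hRF2 : Summable fun x => normSq x * |RF x|)
    (hform : ∀ k ∈ cube d,
      tauHat d p k * (1 - (cF + αF * Dhat d k + cosFT RF k)) = cΦ + αΦ * Dhat d k + cosFT RΦ k)
    {r : F3Bounds.Args} (hKB : ∀ k ∈ cube d, Dhat d k < 1 → (lapAtomsAt d cΦ αΦ cF αF RΦ RF k).KeyBounds r)
    (τ : F3Bounds.Tables (Fin d → ℤ)) (hK : ∀ m l x, τ.K m l x = srwK d m l x) (l : ℕ) (x : Site d)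
    (hI1 : Integrable (fun k => (lapAtomsAt d cΦ αΦ cF αF RΦ RF k).H1 * (lapAtomsAt d cΦ αΦ cF αF RΦ RF k).G ^ n *
      Dhat d k ^ l * DhatSym d x k) (P d))
    (hI2 : Integrable (fun k => (lapAtomsAt d cΦ αΦ cF αF RΦ RF k).H2 * (lapAtomsAt d cΦ αΦ cF αF RΦ RF k).G ^ n *
      Dhat d k ^ l * DhatSym d x k) (P d))
    (hI3 : Integrable (fun k => (lapAtomsAt d cΦ αΦ cF αF RΦ RF k).H3 * (lapAtomsAt d cΦ αΦ cF αF RΦ RF k).G ^ n *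
      Dhat d k ^ l * DhatSym d x k) (P d))
    (hI4 : Integrable (fun k => (lapAtomsAt d cΦ αΦ cF αF RΦ RF k).H4 * (lapAtomsAt d cΦ αΦ cF αF RΦ RF k).G ^ n *
      Dhat d k ^ l * DhatSym d x k) (P d))
    (hI5 : Integrable (fun k => (lapAtomsAt d cΦ αΦ cF αF RΦ RF k).H5 * (lapAtomsAt d cΦ αΦ cF αF RΦ RF k).G ^ n *
      Dhat d k ^ l * DhatSym d x k) (P d))
    (hH1 : |(∫ k, (lapAtomsAt d cΦ αΦ cF αF RΦ RF k).H1 * (lapAtomsAt d cΦ αΦ cF αF RΦ RF k).G ^ n *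
        Dhat d k ^ l * DhatSym d x k ∂P d) / (2 * π) ^ d| ≤ F3Bounds.boundH1 τ n l x r)
    (hH2 : |(∫ k, (lapAtomsAt d cΦ αΦ cF αF RΦ RF k).H2 * (lapAtomsAt d cΦ αΦ cF αF RΦ RF k).G ^ n *
        Dhat d k ^ l * DhatSym d x k ∂P d) / (2 * π) ^ d| ≤ F3Bounds.boundH2Phi τ n l x r)
    (hH3 : |(∫ k, (lapAtomsAt d cΦ αΦ cF αF RΦ RF k).H3 * (lapAtomsAt d cΦ αΦ cF αF RΦ RF k).G ^ n *
        Dhat d k ^ l * DhatSym d x k ∂P d) / (2 * π) ^ d| ≤ F3Bounds.boundH3 τ n l x r)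
    (hH5 : |(∫ k, (lapAtomsAt d cΦ αΦ cF αF RΦ RF k).H5 * (lapAtomsAt d cΦ αΦ cF αF RΦ RF k).G ^ n *
        Dhat d k ^ l * DhatSym d x k ∂P d) / (2 * π) ^ d| ≤ F3Bounds.boundH5 τ n l x r) :
    |nobleH d n l p x| ≤ F3Bounds.boundHD75Phi τ n l x r :=
  abs_nobleH_le_sum_of_pieces hd hp hRΦ hRF hRΦ2 hRF2 hform hKB l x hI1 hI2 hI3 hI4 hI5 hH1 hH2 hH3
    (abs_integral_H4_diagram_le_boundH4D75_lapAtomsAt hd hKB τ hK l x) hH5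

/-! ## 4. The consumers of `NobleWeightedDiagramBound`, re-cut on the derived cell (no (H-Γ)) -/

/-- **`|ℋ^{n,l}_p(x)| ≤ boundHD75Phi τ n l x r`** for fixed witnesses (`d ≥ 2n + 7`): `abs_nobleH_le_boundHD75_of_step1` with Step 2 on the derived cell,
hence WITHOUT (H-Γ); Step 1 displayed (`hH1`), table side `K = srwK`, `U = srwU`, `srwTS ≤ T`.
[cite: FitznerVanDerHofstad2016NoBLE, §3.3.5 (3.58)–(3.59), (3.61), (3.72)–(3.87), PTRF pp. 1074–1079] -/
theorem abs_nobleH_le_boundHD75Phi_of_step1 {n : ℕ} (hd : 2 * (n + 3) + 1 ≤ d) {p : unitInterval}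
    (hp : (p : ℝ) < criticalProb (zdGraph d) (0 : Site d)) {cΦ αΦ cF αF : ℝ} {RΦ RF : Site d → ℝ}
    (hRΦ : Summable RΦ) (hRF : Summable RF) (hRΦ2 : Summable fun x => normSq x * |RΦ x|)
    (hRF2 : Summable fun x => normSq x * |RF x|)
    (hform : ∀ k ∈ cube d,
      tauHat d p k * (1 - (cF + αF * Dhat d k + cosFT RF k)) = cΦ + αΦ * Dhat d k + cosFT RΦ k)
    {r : F3Bounds.Args} (hKB : ∀ k ∈ cube d, Dhat d k < 1 → (lapAtomsAt d cΦ αΦ cF αF RΦ RF k).KeyBounds r)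
    (hr : r.WF)
    (τ : F3Bounds.Tables (Fin d → ℤ)) (hK : ∀ m l x, τ.K m l x = srwK d m l x) (hU : ∀ m l x, τ.U m l x = srwU d m l x)
    (hT : ∀ m l x, srwTS d r.afmin m l x ≤ τ.T m l x) (l : ℕ) (x : Site d)
    (hH1 : |(∫ k, (lapAtomsAt d cΦ αΦ cF αF RΦ RF k).H1 * (lapAtomsAt d cΦ αΦ cF αF RΦ RF k).G ^ n *
        Dhat d k ^ l * DhatSym d x k ∂P d) / (2 * π) ^ d| ≤ F3Bounds.boundH1 τ n l x r) :
    |nobleH d n l p x| ≤ F3Bounds.boundHD75Phi τ n l x r :=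
  have hd' : 2 * (n + 2) + 1 ≤ d := by omega
  abs_nobleH_le_boundHD75Phi_of_pieces hd' hp hRΦ hRF hRΦ2 hRF2 hform hKB τ hK l x
    (integrable_piece_H1 hd' hRΦ hRF hRΦ2 hRF2 hKB l x) (integrable_piece_H2 hd' hRΦ hRF hRΦ2 hRF2 hKB l x)
    (integrable_piece_H3 hd' hRΦ hRF hRΦ2 hRF2 hKB l x) (integrable_piece_H4 hd' hRΦ hRF hRΦ2 hRF2 hKB l x)
    (integrable_piece_H5 hd' hRΦ hRF hRΦ2 hRF2 hKB l x) hH1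
    (abs_integral_H2_diagram_le_boundH2Phi_lapAtomsAt hd hKB hr τ hT l x)
    (abs_integral_H3_diagram_le_boundH3_lapAtomsAt hd hKB τ hU l x)
    (abs_integral_H5_diagram_le_boundH5_lapAtomsAt hd hKB τ hU l x)

/-- **`|ℋ^{n,l}_p(x)| ≤ boundHD75Phi τ n l x r` at an admissible witness** (`NobleF3Witness`), `d ≥ 2n + 7`, `r.WF`, table side, Step 1 at the witness —
no (H-Γ). [cite: FitznerVanDerHofstad2016NoBLE, §3.3.5 (3.58)–(3.87) pp. 1074–1079] -/
theorem NobleF3Witness.abs_nobleH_le_boundHD75Phi {p : unitInterval} {B : NobleBeta} {E : NobleBetaF3} {r : F3Bounds.Args}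
    {cΦ αΦ cF αF : ℝ} {RΦ RF : Site d → ℝ} (w : NobleF3Witness d p B E r cΦ αΦ cF αF RΦ RF) {n : ℕ} (hd : 2 * (n + 3) + 1 ≤ d)
    (hp : (p : ℝ) < criticalProb (zdGraph d) (0 : Site d)) (hr : r.WF)
    (τ : F3Bounds.Tables (Fin d → ℤ)) (hK : ∀ m l x, τ.K m l x = srwK d m l x) (hU : ∀ m l x, τ.U m l x = srwU d m l x)
    (hT : ∀ m l x, srwTS d r.afmin m l x ≤ τ.T m l x) (l : ℕ) (x : Site d)
    (hH1 : |(∫ k, (lapAtomsAt d cΦ αΦ cF αF RΦ RF k).H1 * (lapAtomsAt d cΦ αΦ cF αF RΦ RF k).G ^ n *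
        Dhat d k ^ l * DhatSym d x k ∂P d) / (2 * π) ^ d| ≤ F3Bounds.boundH1 τ n l x r) :
    |nobleH d n l p x| ≤ F3Bounds.boundHD75Phi τ n l x r :=
  abs_nobleH_le_boundHD75Phi_of_step1 hd hp w.summableΦ w.summableF w.summable_normSq_RΦ w.summable_normSq_RF w.form
    w.keyBounds hr τ hK hU hT l x hH1

/-- **`|ℋ^{n,l}_p(x)| ≤ boundHD75Phi τ n l x r`** (`d ≥ 2n + 7`) from the EXISTENCE of an admissible witness at `r`, `r.WF`, the table side and the Step-1
bound `hStep1` for every admissible witness — `abs_nobleH_le_boundHD75_of_witness` without (H-Γ).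
[cite: FitznerVanDerHofstad2016NoBLE, §3.3.5 (3.58)–(3.59) p. 1074, (3.60)–(3.87) pp. 1075–1079] -/
theorem abs_nobleH_le_boundHD75Phi_of_witness {n : ℕ} (hd : 2 * (n + 3) + 1 ≤ d) {p : unitInterval}
    (hp : (p : ℝ) < criticalProb (zdGraph d) (0 : Site d)) {B : NobleBeta} {E : NobleBetaF3} {r : F3Bounds.Args}
    (hW : ∃ (cΦ αΦ cF αF : ℝ) (RΦ RF : Site d → ℝ), NobleF3Witness d p B E r cΦ αΦ cF αF RΦ RF)
    (hr : r.WF)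
    (τ : F3Bounds.Tables (Fin d → ℤ)) (hK : ∀ m l x, τ.K m l x = srwK d m l x) (hU : ∀ m l x, τ.U m l x = srwU d m l x)
    (hT : ∀ m l x, srwTS d r.afmin m l x ≤ τ.T m l x) (l : ℕ) (x : Site d)
    (hStep1 : ∀ ⦃cΦ αΦ cF αF : ℝ⦄ ⦃RΦ RF : Site d → ℝ⦄, NobleF3Witness d p B E r cΦ αΦ cF αF RΦ RF →
      |(∫ k, (lapAtomsAt d cΦ αΦ cF αF RΦ RF k).H1 * (lapAtomsAt d cΦ αΦ cF αF RΦ RF k).G ^ n *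
        Dhat d k ^ l * DhatSym d x k ∂P d) / (2 * π) ^ d| ≤ F3Bounds.boundH1 τ n l x r) :
    |nobleH d n l p x| ≤ F3Bounds.boundHD75Phi τ n l x r := by
  obtain ⟨cΦ, αΦ, cF, αF, RΦ, RF, w⟩ := hW
  exact w.abs_nobleH_le_boundHD75Phi hd hp hr τ hK hU hT l x (hStep1 w)

/-- **The six weighted-diagram cells of `f₃` on the derived cell** — `d ≥ 9`, below `p_c`, an admissible witness at well-formed `r`, the table side,
the Step-1 bound at `n = 0, 1` for every admissible witness, and the six NUMERIC cell hypotheses `boundHD75Phi τ n_k l_k x r ≤ b_k` (`x ∈ S_k`,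
`𝒮 = {(0,0,𝒳),(1,0,𝒳),(1,1,𝒳),(1,2,𝒳),(1,3,𝒳),(1,6,{0})}`, `b_k ≥ 0`): then `NobleWeightedDiagramBoundAt d p b`.  No (H-Γ).
[cite: FitznerVanDerHofstad2016NoBLE, §3.3.5 (3.87) p. 1079 with (3.58)–(3.59) p. 1074] [cite: FitznerVanDerHofstad2017, (2.21)–(2.23), §2.5 (EJP pp. 8–9, 11–12)] -/
theorem nobleWeightedDiagramBoundAt_of_witness_phi (hd : 9 ≤ d) {p : unitInterval}
    (hp : (p : ℝ) < criticalProb (zdGraph d) (0 : Site d)) {B : NobleBeta} {E : NobleBetaF3} {r : F3Bounds.Args}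
    (hW : ∃ (cΦ αΦ cF αF : ℝ) (RΦ RF : Site d → ℝ), NobleF3Witness d p B E r cΦ αΦ cF αF RΦ RF)
    (hr : r.WF)
    (τ : F3Bounds.Tables (Fin d → ℤ)) (hK : ∀ m l x, τ.K m l x = srwK d m l x) (hU : ∀ m l x, τ.U m l x = srwU d m l x)
    (hT : ∀ m l x, srwTS d r.afmin m l x ≤ τ.T m l x)
    (hStep1 : ∀ n ≤ 1, ∀ (l : ℕ) (x : Site d), ∀ ⦃cΦ αΦ cF αF : ℝ⦄ ⦃RΦ RF : Site d → ℝ⦄,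
      NobleF3Witness d p B E r cΦ αΦ cF αF RΦ RF →
      |(∫ k, (lapAtomsAt d cΦ αΦ cF αF RΦ RF k).H1 * (lapAtomsAt d cΦ αΦ cF αF RΦ RF k).G ^ n *
        Dhat d k ^ l * DhatSym d x k ∂P d) / (2 * π) ^ d| ≤ F3Bounds.boundH1 τ n l x r)
    {b : Fin 6 → ℝ} (hb : ∀ k, 0 ≤ b k)
    (h0 : ∀ x ∈ calX d, F3Bounds.boundHD75Phi τ 0 0 x r ≤ b 0) (h1 : ∀ x ∈ calX d, F3Bounds.boundHD75Phi τ 1 0 x r ≤ b 1)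
    (h2 : ∀ x ∈ calX d, F3Bounds.boundHD75Phi τ 1 1 x r ≤ b 2) (h3 : ∀ x ∈ calX d, F3Bounds.boundHD75Phi τ 1 2 x r ≤ b 3)
    (h4 : ∀ x ∈ calX d, F3Bounds.boundHD75Phi τ 1 3 x r ≤ b 4) (h5 : F3Bounds.boundHD75Phi τ 1 6 0 r ≤ b 5) :
    NobleWeightedDiagramBoundAt d p b := by
  have hle : ∀ {n : ℕ}, n ≤ 1 → ∀ (l : ℕ) (x : Site d), nobleH d n l p x ≤ F3Bounds.boundHD75Phi τ n l x r :=
    fun {n} hn l x => (le_abs_self _).trans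
      (abs_nobleH_le_boundHD75Phi_of_witness (n := n) (by omega) hp hW hr τ hK hU hT l x (hStep1 n hn l x))
  have hz : (0 : ℕ) ≤ 1 := Nat.zero_le 1
  intro k
  fin_cases k
  · show nobleSupH d 0 0 (calX d) p ≤ b 0
    exact nobleSupH_le_of_forall (hb 0) fun x hx => (hle hz 0 x).trans (h0 x hx)
  · show nobleSupH d 1 0 (calX d) p ≤ b 1
    exact nobleSupH_le_of_forall (hb 1) fun x hx => (hle le_rfl 0 x).trans (h1 x hx)
  · show nobleSupH d 1 1 (calX d) p ≤ b 2
    exact nobleSupH_le_of_forall (hb 2) fun x hx => (hle le_rfl 1 x).trans (h2 x hx)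
  · show nobleSupH d 1 2 (calX d) p ≤ b 3
    exact nobleSupH_le_of_forall (hb 3) fun x hx => (hle le_rfl 2 x).trans (h3 x hx)
  · show nobleSupH d 1 3 (calX d) p ≤ b 4
    exact nobleSupH_le_of_forall (hb 4) fun x hx => (hle le_rfl 3 x).trans (h4 x hx)
  · show nobleSupH d 1 6 ({0} : Set (Site d)) p ≤ b 5
    exact nobleSupH_le_of_forall (hb 5) fun x hx => by
      rw [Set.mem_singleton_iff] at hx
      subst hx
      exact (hle le_rfl 6 0).trans h5

/-- **The six cells from the extended simplified form** `NobleSimplifiedFormF3At d p B E` below `p_c` under `f₂(p) ≤ Γ₂`, at `r = NobleBetaF3.toArgs d B E Γ₂`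
(`0 < α̲_F`, `β̲_{ΔR,F} < α̲_F`), on the derived cell — no (H-Γ).
[cite: FitznerVanDerHofstad2016NoBLE, §3.3.5 (3.87) p. 1079; §3.3.4 pp. 1072–1074] [cite: FitznerVanDerHofstad2017, (2.21)–(2.23), §2.5] -/
theorem nobleWeightedDiagramBoundAt_of_simplifiedFormF3_phi (hd : 9 ≤ d) {p : unitInterval}
    (hp : (p : ℝ) < criticalProb (zdGraph d) (0 : Site d)) {B : NobleBeta} {E : NobleBetaF3} {Γ₂ : ℝ}
    (hF3 : NobleSimplifiedFormF3At d p B E) (hΓ2 : nobleF2 d p ≤ Γ₂) (hαFlow : 0 < B.αFlow) (hgap : B.βΔ < B.αFlow)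
    (hr : (NobleBetaF3.toArgs d B E Γ₂).WF)
    (τ : F3Bounds.Tables (Fin d → ℤ)) (hK : ∀ m l x, τ.K m l x = srwK d m l x) (hU : ∀ m l x, τ.U m l x = srwU d m l x)
    (hT : ∀ m l x, srwTS d (NobleBetaF3.toArgs d B E Γ₂).afmin m l x ≤ τ.T m l x)
    (hStep1 : ∀ n ≤ 1, ∀ (l : ℕ) (x : Site d), ∀ ⦃cΦ αΦ cF αF : ℝ⦄ ⦃RΦ RF : Site d → ℝ⦄,
      NobleF3Witness d p B E (NobleBetaF3.toArgs d B E Γ₂) cΦ αΦ cF αF RΦ RF →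
      |(∫ k, (lapAtomsAt d cΦ αΦ cF αF RΦ RF k).H1 * (lapAtomsAt d cΦ αΦ cF αF RΦ RF k).G ^ n *
        Dhat d k ^ l * DhatSym d x k ∂P d) / (2 * π) ^ d| ≤ F3Bounds.boundH1 τ n l x (NobleBetaF3.toArgs d B E Γ₂))
    {b : Fin 6 → ℝ} (hb : ∀ k, 0 ≤ b k)
    (h0 : ∀ x ∈ calX d, F3Bounds.boundHD75Phi τ 0 0 x (NobleBetaF3.toArgs d B E Γ₂) ≤ b 0)
    (h1 : ∀ x ∈ calX d, F3Bounds.boundHD75Phi τ 1 0 x (NobleBetaF3.toArgs d B E Γ₂) ≤ b 1)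
    (h2 : ∀ x ∈ calX d, F3Bounds.boundHD75Phi τ 1 1 x (NobleBetaF3.toArgs d B E Γ₂) ≤ b 2)
    (h3 : ∀ x ∈ calX d, F3Bounds.boundHD75Phi τ 1 2 x (NobleBetaF3.toArgs d B E Γ₂) ≤ b 3)
    (h4 : ∀ x ∈ calX d, F3Bounds.boundHD75Phi τ 1 3 x (NobleBetaF3.toArgs d B E Γ₂) ≤ b 4)
    (h5 : F3Bounds.boundHD75Phi τ 1 6 0 (NobleBetaF3.toArgs d B E Γ₂) ≤ b 5) :
    NobleWeightedDiagramBoundAt d p b :=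
  nobleWeightedDiagramBoundAt_of_witness_phi hd hp (hF3.exists_witness (by omega) hp hΓ2 hαFlow hgap) hr τ hK hU hT
    hStep1 hb h0 h1 h2 h3 h4 h5

/-- **The improvement-step input `NobleImprovementInputsAt d cμ c Γ B b` from the extended simplified form, Step 1, the table side and the six cells ON THE
DERIVED CELL** (`d ≥ 9`) — `nobleImprovementInputsAt_of_simplifiedFormF3` without (H-Γ): the simplified form by `NobleSimplifiedFormF3At.toSimplifiedFormAt`,
the weighted-diagram bounds by `nobleWeightedDiagramBoundAt_of_simplifiedFormF3_phi`.
[cite: FitznerVanDerHofstad2016NoBLE, §3.3.5 (3.87) p. 1079; Assumption 2.7 and Prop. 4.5 (pp. 1059–1060, 1088)] [cite: FitznerVanDerHofstad2017, Prop. 2.1–2.2, (2.21)–(2.23), §2.5] -/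
theorem nobleImprovementInputsAt_of_simplifiedFormF3_phi (hd : 9 ≤ d) {cμ : ℝ} {c : Fin 6 → ℝ} {Γ : Fin 3 → ℝ}
    {B : NobleBeta} {E : NobleBetaF3}
    (hF3 : ∀ p : unitInterval, p ∈ Set.Ioo (nbwThresholdI d) (criticalProbI d) →
      (∀ i, nobleF d cμ c i p ≤ Γ i) → NobleSimplifiedFormF3At d p B E)
    (hαFlow : 0 < B.αFlow) (hgap : B.βΔ < B.αFlow) (hr : (NobleBetaF3.toArgs d B E (Γ 1)).WF)
    (τ : F3Bounds.Tables (Fin d → ℤ)) (hK : ∀ m l x, τ.K m l x = srwK d m l x) (hU : ∀ m l x, τ.U m l x = srwU d m l x)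
    (hT : ∀ m l x, srwTS d (NobleBetaF3.toArgs d B E (Γ 1)).afmin m l x ≤ τ.T m l x)
    (hStep1 : ∀ p : unitInterval, p ∈ Set.Ioo (nbwThresholdI d) (criticalProbI d) → (∀ i, nobleF d cμ c i p ≤ Γ i) →
      ∀ n ≤ 1, ∀ (l : ℕ) (x : Site d), ∀ ⦃cΦ αΦ cF αF : ℝ⦄ ⦃RΦ RF : Site d → ℝ⦄,
      NobleF3Witness d p B E (NobleBetaF3.toArgs d B E (Γ 1)) cΦ αΦ cF αF RΦ RF →
      |(∫ k, (lapAtomsAt d cΦ αΦ cF αF RΦ RF k).H1 * (lapAtomsAt d cΦ αΦ cF αF RΦ RF k).G ^ n *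
        Dhat d k ^ l * DhatSym d x k ∂P d) / (2 * π) ^ d| ≤ F3Bounds.boundH1 τ n l x (NobleBetaF3.toArgs d B E (Γ 1)))
    {b : Fin 6 → ℝ} (hb : ∀ k, 0 ≤ b k)
    (h0 : ∀ x ∈ calX d, F3Bounds.boundHD75Phi τ 0 0 x (NobleBetaF3.toArgs d B E (Γ 1)) ≤ b 0)
    (h1 : ∀ x ∈ calX d, F3Bounds.boundHD75Phi τ 1 0 x (NobleBetaF3.toArgs d B E (Γ 1)) ≤ b 1)
    (h2 : ∀ x ∈ calX d, F3Bounds.boundHD75Phi τ 1 1 x (NobleBetaF3.toArgs d B E (Γ 1)) ≤ b 2)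
    (h3 : ∀ x ∈ calX d, F3Bounds.boundHD75Phi τ 1 2 x (NobleBetaF3.toArgs d B E (Γ 1)) ≤ b 3)
    (h4 : ∀ x ∈ calX d, F3Bounds.boundHD75Phi τ 1 3 x (NobleBetaF3.toArgs d B E (Γ 1)) ≤ b 4)
    (h5 : F3Bounds.boundHD75Phi τ 1 6 0 (NobleBetaF3.toArgs d B E (Γ 1)) ≤ b 5) :
    NobleImprovementInputsAt d cμ c Γ B b := by
  intro p hp hf
  have hF := hF3 p hp hf
  have hpc : (p : ℝ) < criticalProb (zdGraph d) (0 : Site d) := by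
    rw [← coe_criticalProbI]
    exact Subtype.coe_lt_coe.2 hp.2
  have hΓ2 : nobleF2 d p ≤ Γ 1 := by simpa only [nobleF_one] using hf 1
  exact ⟨hF.toSimplifiedFormAt, nobleWeightedDiagramBoundAt_of_simplifiedFormF3_phi hd hpc hF hΓ2 hαFlow hgap hr τ hK hU hT
    (hStep1 p hp hf) hb h0 h1 h2 h3 h4 h5⟩

end Literature.Probability.FitznerVanDerHofstad2017

end
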